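import Summits.NavierStokesRegularity.NavierStokesRegularity.Theorems.ScenarioCensusLoudnessMeter
import HarnessLib

/-!
# LINE «loudness-meter» port, part 2/2: §C the rows in the (L′)-shape, row proofs, controls and calibration (`ssField`); census KEYS `Row_A2arD` … `Row_A2arK` + `_excluded`,
# `Row_A2arP` (OPEN)

Re-homed for the scenario census (typer seat ns-census-typer-1 g9; the cells A2arD / A2arB / A2arS / A2arT / A2arL / A2arF / A2arR / A2arK are members of block A2
«DECIDED IN KERNEL IN FILES» (ref ns-census-ref g12 PRE-CHECK ✓ §17.14; critic PASS; lead label); this port makes them TREE-decided): VERBATIM PORT of ns-idea-2 LINE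
g16-2 «loudness-meter», `pub/ideators/ns-idea-2/lines/loudness-meter/line-loudness-meter.lean` sha16 913bd0567793a8c3 (471 l., lean check rc 0, 0 sorry), split for
the 400-line rule into `ScenarioCensusLoudnessMeter` (§A–§B) → `…LoudnessMeterRows` (§C + census KEYS).  Lean text VERBATIM in namespace
`…Theorems.ScenarioCensus.LoudnessMeter` (the line's `…Lines.LoudnessMeter` re-homed); port edits: `local notation "E3"` → `abbrev E3` (typer lint: no notation in port
files), `set_option linter.unusedVariables false` dropped (ref §17.14: a port must drop it), the `variable {C} {u}` line repeated at the head of part 2, `@[conjecture]`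
on the OPEN residual row `Row_A2arP` (typed only), ten one-line docstrings added and seven unused binder names `_`-prefixed (gate lint: 0 warnings; proof text only).  Statements untouched.

No census VALUE is moved here (the cells become TREE-decided by name; booking is the lead's); NS regularity is NOT proved; (L′) ⟨10661⟩ is untouched; no
summit statement is proved by this file.
-/

-- the summit and its single problem share the name `NavierStokesRegularity` (D-0017 nested layout)
set_option linter.dupNamespace false

noncomputable section

open Set Function Filter Metric
open scoped Topology
open Literature.Analysis.FluidPDE
open Summit.NavierStokesRegularity.NavierStokesRegularity.Theorems
open Summit.NavierStokesRegularity.NavierStokesRegularity.Theorems.SimilarityEnstrophy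

namespace Summit.NavierStokesRegularity.NavierStokesRegularity.Theorems.ScenarioCensus.LoudnessMeter

variable {C : ℝ} {u : ℝ → E3 → E3}

/-! ## C. Rows (census (L′)-shape) -/

/-- **Row A2ar-D** (master cell): a DENSE set of similarity positions `η` at each of which
`√(−s)‖u(s, √(−s)η)‖ ≤ ε` for all sufficiently negative `s` (one `ε < 1`; the threshold time may depend on
`η`) ⇒ `u ≡ 0`.  EXCLUDED — PROVED `row_A2arD`. -/
def Row_A2arD : Prop :=
  ∀ (C : ℝ) (u : ℝ → E3 → E3), IsTypeIAncientMild C u →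
    (∃ ε : ℝ, ε < 1 ∧ ∃ D : Set E3, Dense D ∧ ∀ η ∈ D, ∃ T : ℝ, T < 0 ∧ ∀ s : ℝ, s < T →
        Real.sqrt (-s) * ‖u s (Real.sqrt (-s) • η)‖ ≤ ε) →
    ∀ t < 0, ∀ x, u t x = 0

/-- **Row A2arD holds** (master cell). -/
theorem row_A2arD : Row_A2arD := fun _ _ hu ⟨_, hε, _, hD, hq⟩ =>
  eq_zero_of_quiet_dense hu hε hD fun η hη => hq η hη

/-- **Row A2ar-B** (bounded active region): on a far-past end the scale-invariant amplitude is `≤ ε < 1`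
OUTSIDE A FIXED BALL `‖x‖ ≥ R₀` ⇒ `u ≡ 0`.  EXCLUDED — PROVED `row_A2arB`. -/
def Row_A2arB : Prop :=
  ∀ (C : ℝ) (u : ℝ → E3 → E3), IsTypeIAncientMild C u →
    (∃ ε : ℝ, ε < 1 ∧ ∃ R₀ T : ℝ, T < 0 ∧ ∀ s : ℝ, s < T → ∀ x : E3, R₀ ≤ ‖x‖ →
        Real.sqrt (-s) * ‖u s x‖ ≤ ε) →
    ∀ t < 0, ∀ x, u t x = 0

/-- **Row A2ar-S** (sub-parabolic active region): quiet outside balls of radius `r(s)` with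
`r(s)/√(−s) → 0` as `s → −∞` ⇒ `u ≡ 0`.  EXCLUDED — PROVED `row_A2arS`. -/
def Row_A2arS : Prop :=
  ∀ (C : ℝ) (u : ℝ → E3 → E3), IsTypeIAncientMild C u →
    (∃ ε : ℝ, ε < 1 ∧ ∃ r : ℝ → ℝ, Tendsto (fun s => r s / Real.sqrt (-s)) atBot (𝓝 0) ∧
      ∃ T : ℝ, T < 0 ∧ ∀ s : ℝ, s < T → ∀ x : E3, r s ≤ ‖x‖ → Real.sqrt (-s) * ‖u s x‖ ≤ ε) →
    ∀ t < 0, ∀ x, u t x = 0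

/-- **Row A2ar-T** (tube): quiet outside a fixed TUBE `x₀² + x₁² < ρ²` about the `x₃`-axis on a far-past
end ⇒ `u ≡ 0` (any line: the class is rigid-motion covariant).  EXCLUDED — PROVED `row_A2arT`. -/
def Row_A2arT : Prop :=
  ∀ (C : ℝ) (u : ℝ → E3 → E3), IsTypeIAncientMild C u →
    (∃ ε : ℝ, ε < 1 ∧ ∃ ρ T : ℝ, T < 0 ∧ ∀ s : ℝ, s < T → ∀ x : E3, ρ ^ 2 ≤ x 0 ^ 2 + x 1 ^ 2 →
        Real.sqrt (-s) * ‖u s x‖ ≤ ε) →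
    ∀ t < 0, ∀ x, u t x = 0

/-- **Row A2ar-L** (layer / slab): quiet outside a fixed SLAB `|x₃| < ρ` on a far-past end ⇒ `u ≡ 0`.
EXCLUDED — PROVED `row_A2arL`. -/
def Row_A2arL : Prop :=
  ∀ (C : ℝ) (u : ℝ → E3 → E3), IsTypeIAncientMild C u →
    (∃ ε : ℝ, ε < 1 ∧ ∃ ρ T : ℝ, T < 0 ∧ ∀ s : ℝ, s < T → ∀ x : E3, ρ ≤ |x 2| →
        Real.sqrt (-s) * ‖u s x‖ ≤ ε) →
    ∀ t < 0, ∀ x, u t x = 0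

/-- **Row A2ar-F** (fixed asymptotic similarity position of a compact core): quiet outside the balls
`B(c(s), R₀)` for a centre path with `c(s)/√(−s) → η₀` ⇒ `u ≡ 0`.  EXCLUDED — PROVED `row_A2arF`. -/
def Row_A2arF : Prop :=
  ∀ (C : ℝ) (u : ℝ → E3 → E3), IsTypeIAncientMild C u →
    (∃ ε : ℝ, ε < 1 ∧ ∃ (c : ℝ → E3) (η₀ : E3), Tendsto (fun s => (Real.sqrt (-s))⁻¹ • c s) atBot (𝓝 η₀) ∧
      ∃ R₀ T : ℝ, T < 0 ∧ ∀ s : ℝ, s < T → ∀ x : E3, R₀ ≤ ‖x - c s‖ → Real.sqrt (-s) * ‖u s x‖ ≤ ε) →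
    ∀ t < 0, ∀ x, u t x = 0

/-- **Row A2ar-R** (runaway compact core): quiet outside the balls `B(c(s), R₀)` for a centre path with
`‖c(s)‖/√(−s) → ∞` ⇒ `u ≡ 0`.  EXCLUDED — PROVED `row_A2arR`. -/
def Row_A2arR : Prop :=
  ∀ (C : ℝ) (u : ℝ → E3 → E3), IsTypeIAncientMild C u →
    (∃ ε : ℝ, ε < 1 ∧ ∃ c : ℝ → E3, Tendsto (fun s => ‖c s‖ / Real.sqrt (-s)) atBot atTop ∧
      ∃ R₀ T : ℝ, T < 0 ∧ ∀ s : ℝ, s < T → ∀ x : E3, R₀ ≤ ‖x - c s‖ → Real.sqrt (-s) * ‖u s x‖ ≤ ε) →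
    ∀ t < 0, ∀ x, u t x = 0

/-- **Row A2ar-K** (quiet parabolic cores of every aperture): for every `ε > 0` and every `K > 0` the field
is `ε`-quiet on the paraboloid `‖x‖ ≤ K√(−s)` for all sufficiently negative `s` ⇒ `u ≡ 0` (the paraboloid
twin of the tree's linear-cone row S3-lin).  EXCLUDED — PROVED `row_A2arK`; CALIBRATION ROW: also a direct
corollary of the tree's `ScrewBlowdown.substantial_at_large_scales` (ns-idea-4 v1.9), no novelty claimed. -/
def Row_A2arK : Prop :=
  ∀ (C : ℝ) (u : ℝ → E3 → E3), IsTypeIAncientMild C u →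
    (∀ ε : ℝ, 0 < ε → ∀ K : ℝ, 0 < K → ∃ T : ℝ, T < 0 ∧ ∀ s : ℝ, s < T → ∀ x : E3,
        ‖x‖ ≤ K * Real.sqrt (-s) → Real.sqrt (-s) * ‖u s x‖ ≤ ε) →
    ∀ t < 0, ∀ x, u t x = 0

/-- **Row A2ar-P** (paraboloidal active region — the residual): on a far-past end the field is `ε`-quiet
(`ε < 1`) OUTSIDE the paraboloid `‖x‖ ≤ K√(−s)` ⇒ `u ≡ 0`.  OPEN typed (self-similar-type concentration;
not decided here). -/
@[conjecture] def Row_A2arP : Prop :=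
  ∀ (C : ℝ) (u : ℝ → E3 → E3), IsTypeIAncientMild C u →
    (∃ ε : ℝ, ε < 1 ∧ ∃ K T : ℝ, T < 0 ∧ ∀ s : ℝ, s < T → ∀ x : E3, K * Real.sqrt (-s) ≤ ‖x‖ →
        Real.sqrt (-s) * ‖u s x‖ ≤ ε) →
    ∀ t < 0, ∀ x, u t x = 0

/-! ### Row proofs -/

/-- Density of the complement of a point in `ℝ³`. -/
theorem dense_ne (η₀ : E3) : Dense {η : E3 | η ≠ η₀} := by
  haveI : ∀ y : E3, (𝓝[≠] y).NeBot := fun y => Module.punctured_nhds_neBot ℝ E3 y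
  simpa [Set.compl_def] using dense_compl_singleton η₀

/-- Density of the complement of a coordinate hyperplane in `ℝ³`. -/
theorem dense_coord_ne_zero (i : Fin 3) : Dense {η : E3 | η i ≠ 0} := by
  refine Metric.dense_iff.2 fun η₀ δ hδ => ?_
  by_cases h0 : η₀ i = 0
  · refine ⟨η₀ + (δ / 2) • EuclideanSpace.single i 1, mem_ball.2 ?_, ?_⟩
    · simp [dist_eq_norm, norm_smul, abs_of_pos hδ]
      linarith
    · show (η₀ + (δ / 2) • EuclideanSpace.single i (1 : ℝ)) i ≠ 0
      simp [h0, hδ.ne']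
  · exact ⟨η₀, mem_ball_self hδ, h0⟩

/-- **Row A2arS holds.** -/
theorem row_A2arS : Row_A2arS := by
  rintro C u hu ⟨ε, hε, r, hr, T₀, hT₀, hq⟩
  refine eq_zero_of_quiet_dense hu hε (dense_ne 0) fun η hη => ?_
  have hηpos : 0 < ‖η‖ := norm_pos_iff.2 hη
  have hev : ∀ᶠ s in atBot, r s / Real.sqrt (-s) < ‖η‖ := hr.eventually (gt_mem_nhds hηpos)
  obtain ⟨T₁, hT₁⟩ := Filter.eventually_atBot.1 hev
  refine ⟨min T₀ (min T₁ (-1)), by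
    have := min_le_right T₀ (min T₁ (-1)); have := min_le_right T₁ (-1 : ℝ); linarith, fun s hs => ?_⟩
  have hs0 : s < T₀ := lt_of_lt_of_le hs (min_le_left _ _)
  have hs1 : s ≤ T₁ := (lt_of_lt_of_le hs ((min_le_right _ _).trans (min_le_left _ _))).le
  have hsneg : s < 0 := by
    have := (min_le_right T₀ (min T₁ (-1))).trans (min_le_right T₁ (-1 : ℝ)); linarith
  have hsr : 0 < Real.sqrt (-s) := Real.sqrt_pos.2 (by linarith)
  have h1 : r s < ‖η‖ * Real.sqrt (-s) := (div_lt_iff₀ hsr).1 (hT₁ s hs1)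
  refine hq s hs0 _ ?_
  rw [norm_smul, Real.norm_eq_abs, abs_of_pos hsr]
  linarith

/-- **Row A2arB holds.** -/
theorem row_A2arB : Row_A2arB := by
  rintro C u hu ⟨ε, hε, R₀, T₀, hT₀, hq⟩
  refine row_A2arS C u hu ⟨ε, hε, fun _ => R₀, ?_, T₀, hT₀, fun s hs x hx => hq s hs x hx⟩
  -- `R₀/√(−s) → 0` as `s → −∞`
  have h1 : Tendsto (fun s : ℝ => Real.sqrt (-s)) atBot atTop :=
    Real.tendsto_sqrt_atTop.comp tendsto_neg_atBot_atTop
  simpa [div_eq_mul_inv] using h1.inv_tendsto_atTop.const_mul R₀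

/-- **Row A2arT holds.** -/
theorem row_A2arT : Row_A2arT := by
  rintro C u hu ⟨ε, hε, ρ, T₀, hT₀, hq⟩
  refine eq_zero_of_quiet_dense hu hε (dense_coord_ne_zero 0) fun η hη => ?_
  have hη' : η 0 ≠ 0 := hη
  have hη2 : 0 < η 0 ^ 2 := by positivity
  have hq0 : 0 ≤ ρ ^ 2 / η 0 ^ 2 := by positivity
  have hmin := min_le_right T₀ (-(ρ ^ 2 / η 0 ^ 2 + 1))
  refine ⟨min T₀ (-(ρ ^ 2 / η 0 ^ 2 + 1)), by linarith, fun s hs => ?_⟩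
  have hs0 : s < T₀ := lt_of_lt_of_le hs (min_le_left _ _)
  have hs1 : ρ ^ 2 / η 0 ^ 2 < -s := by linarith
  have hsneg : 0 ≤ -s := by linarith
  refine hq s hs0 _ ?_
  have h2 : ρ ^ 2 < -s * η 0 ^ 2 := (div_lt_iff₀ hη2).1 hs1
  have hc0 : (Real.sqrt (-s) • η) 0 = Real.sqrt (-s) * η 0 := by simp
  have hc1 : (Real.sqrt (-s) • η) 1 = Real.sqrt (-s) * η 1 := by simp
  rw [hc0, hc1]
  nlinarith [Real.sq_sqrt hsneg, sq_nonneg (Real.sqrt (-s) * η 1)]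

/-- **Row A2arL holds.** -/
theorem row_A2arL : Row_A2arL := by
  rintro C u hu ⟨ε, hε, ρ, T₀, hT₀, hq⟩
  refine eq_zero_of_quiet_dense hu hε (dense_coord_ne_zero 2) fun η hη => ?_
  have hηpos : 0 < |η 2| := abs_pos.2 hη
  obtain ⟨T₁, hT₁, hfar⟩ := exists_far hηpos ρ
  refine ⟨min T₀ T₁, lt_of_le_of_lt (min_le_left _ _) hT₀, fun s hs => ?_⟩
  have hs0 : s < T₀ := lt_of_lt_of_le hs (min_le_left _ _)
  have hs1 : s < T₁ := lt_of_lt_of_le hs (min_le_right _ _)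
  refine hq s hs0 _ ?_
  have hc2 : (Real.sqrt (-s) • η) 2 = Real.sqrt (-s) * η 2 := by simp
  rw [hc2, abs_mul, abs_of_nonneg (Real.sqrt_nonneg _)]
  exact hfar s hs1

/-- **Row A2arF holds.** -/
theorem row_A2arF : Row_A2arF := by
  rintro C u hu ⟨ε, hε, c, η₀, hc, R₀, T₀, hT₀, hq⟩
  refine eq_zero_of_quiet_dense hu hε (dense_ne η₀) fun η hη => ?_
  have hd : 0 < ‖η - η₀‖ := norm_pos_iff.2 (sub_ne_zero.2 hη)
  -- eventually the rescaled centre is within `‖η − η₀‖/2` of `η₀`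
  have hev : ∀ᶠ s in atBot, dist ((Real.sqrt (-s))⁻¹ • c s) η₀ < ‖η - η₀‖ / 2 :=
    Metric.tendsto_nhds.1 hc _ (by positivity)
  obtain ⟨T₁, hT₁⟩ := Filter.eventually_atBot.1 hev
  obtain ⟨T₂, hT₂, hfar⟩ := exists_far (a := ‖η - η₀‖ / 2) (by positivity) R₀
  refine ⟨min T₀ (min T₁ T₂), by
    have := (min_le_right T₀ (min T₁ T₂)).trans (min_le_right T₁ T₂); linarith, fun s hs => ?_⟩
  have hs0 : s < T₀ := lt_of_lt_of_le hs (min_le_left _ _)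
  have hs1 : s ≤ T₁ := (lt_of_lt_of_le hs ((min_le_right _ _).trans (min_le_left _ _))).le
  have hs2 : s < T₂ := lt_of_lt_of_le hs ((min_le_right _ _).trans (min_le_right _ _))
  have hsr : 0 < Real.sqrt (-s) := Real.sqrt_pos.2 (by linarith)
  refine hq s hs0 _ ((hfar s hs2).trans ?_)
  -- `√(−s)·‖η−η₀‖/2 ≤ ‖√(−s)η − c(s)‖`
  have hfac : Real.sqrt (-s) • η - c s = Real.sqrt (-s) • (η - (Real.sqrt (-s))⁻¹ • c s) := by
    rw [smul_sub, smul_smul, mul_inv_cancel₀ hsr.ne', one_smul]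
  have hdist : ‖(Real.sqrt (-s))⁻¹ • c s - η₀‖ < ‖η - η₀‖ / 2 := by
    simpa [dist_eq_norm] using hT₁ s hs1
  have htri : ‖η - η₀‖ ≤ ‖η - (Real.sqrt (-s))⁻¹ • c s‖ + ‖(Real.sqrt (-s))⁻¹ • c s - η₀‖ :=
    norm_sub_le_norm_sub_add_norm_sub _ _ _
  rw [hfac, norm_smul, Real.norm_eq_abs, abs_of_pos hsr]
  nlinarith [hsr]

/-- **Row A2arR holds.** -/
theorem row_A2arR : Row_A2arR := by
  rintro C u hu ⟨ε, hε, c, hc, R₀, T₀, hT₀, hq⟩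
  refine eq_zero_of_quiet_dense hu hε dense_univ fun η _ => ?_
  have hev : ∀ᶠ s in atBot, ‖η‖ + 1 < ‖c s‖ / Real.sqrt (-s) := hc.eventually_gt_atTop _
  obtain ⟨T₁, hT₁⟩ := Filter.eventually_atBot.1 hev
  obtain ⟨T₂, hT₂, hfar⟩ := exists_far (a := (1 : ℝ)) one_pos R₀
  refine ⟨min T₀ (min T₁ T₂), by
    have := (min_le_right T₀ (min T₁ T₂)).trans (min_le_right T₁ T₂); linarith, fun s hs => ?_⟩
  have hs0 : s < T₀ := lt_of_lt_of_le hs (min_le_left _ _)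
  have hs1 : s ≤ T₁ := (lt_of_lt_of_le hs ((min_le_right _ _).trans (min_le_left _ _))).le
  have hs2 : s < T₂ := lt_of_lt_of_le hs ((min_le_right _ _).trans (min_le_right _ _))
  have hsr : 0 < Real.sqrt (-s) := Real.sqrt_pos.2 (by linarith)
  refine hq s hs0 _ ((hfar s hs2).trans ?_)
  have h1 : (‖η‖ + 1) * Real.sqrt (-s) < ‖c s‖ := (lt_div_iff₀ hsr).1 (hT₁ s hs1)
  have htri : ‖c s‖ ≤ ‖Real.sqrt (-s) • η - c s‖ + ‖Real.sqrt (-s) • η‖ := by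
    have := norm_sub_le (Real.sqrt (-s) • η) (Real.sqrt (-s) • η - c s)
    simp only [sub_sub_cancel] at this
    linarith [norm_sub_rev (Real.sqrt (-s) • η) (Real.sqrt (-s) • η - c s)]
  rw [norm_smul, Real.norm_eq_abs, abs_of_pos hsr] at htri
  nlinarith [norm_nonneg η]

/-- **Row A2arK holds.** -/
theorem row_A2arK : Row_A2arK := by
  intro C u hu hq
  refine eq_zero_of_quiet_dense hu (by norm_num : (1 / 2 : ℝ) < 1) dense_univ fun η _ => ?_
  obtain ⟨T, hT, hT'⟩ := hq (1 / 2) (by norm_num) (‖η‖ + 1) (by positivity)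
  refine ⟨T, hT, fun s hs => hT' s hs _ ?_⟩
  have hsr : 0 ≤ Real.sqrt (-s) := Real.sqrt_nonneg _
  rw [norm_smul, Real.norm_eq_abs, abs_of_nonneg hsr]
  nlinarith [norm_nonneg η]

/-- **LOUD FAR OUT** (PROVED; contrapositive reading of `Row_A2arB`): the `ε`-loud points (`ε < 1`) of a
nonzero element recurrently leave every fixed ball as `s → −∞`. -/
theorem loud_far_out_of_ne_zero (hu : IsTypeIAncientMild C u) (hne : ∃ t < 0, ∃ x, u t x ≠ 0) {ε : ℝ}
    (hε : ε < 1) (R₀ T : ℝ) (hT : T < 0) :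
    ∃ s < T, ∃ x : E3, R₀ ≤ ‖x‖ ∧ ε < Real.sqrt (-s) * ‖u s x‖ := by
  by_contra h
  push Not at h
  obtain ⟨t, ht, x, hx⟩ := hne
  exact hx (row_A2arB C u hu ⟨ε, hε, R₀, T, hT, h⟩ t ht x)

/-- Every row follows from (L′) over the class. PROVED. -/
theorem rows_of_L' (hL : ∀ (C : ℝ) (u : ℝ → E3 → E3), IsTypeIAncientMild C u → ∀ t < 0, ∀ x, u t x = 0) :
    Row_A2arD ∧ Row_A2arB ∧ Row_A2arS ∧ Row_A2arT ∧ Row_A2arL ∧ Row_A2arF ∧ Row_A2arR ∧ Row_A2arK ∧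
      Row_A2arP :=
  ⟨fun C u hu _ => hL C u hu, fun C u hu _ => hL C u hu, fun C u hu _ => hL C u hu,
    fun C u hu _ => hL C u hu, fun C u hu _ => hL C u hu, fun C u hu _ => hL C u hu,
    fun C u hu _ => hL C u hu, fun C u hu _ => hL C u hu, fun C u hu _ => hL C u hu⟩

/-- Bridge to the rung (L′) BY NAME: `Theses.SymmetryModuliCount.TypeIAncientLiouville` ⟨stmt-10661⟩
implies every row. PROVED. -/
theorem rows_of_rung (hL : Theses.SymmetryModuliCount.TypeIAncientLiouville) :
    Row_A2arD ∧ Row_A2arB ∧ Row_A2arS ∧ Row_A2arT ∧ Row_A2arL ∧ Row_A2arF ∧ Row_A2arR ∧ Row_A2arK ∧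
      Row_A2arP :=
  rows_of_L' fun C u hu => hL C u (isTypeIAncientMild_iff.1 hu)

/-! ### Controls and calibration -/

/-- Control: the zero field is eventually quiet everywhere (the rows' hypotheses are satisfiable; the
class, not the reading, carries the exclusion). -/
theorem control_zero_evQuiet {ε : ℝ} (hε : 0 ≤ ε) (η : E3) : EvQuiet ε (0 : ℝ → E3 → E3) η :=
  ⟨-1, by norm_num, fun s _ => by simpa [simAmp] using hε⟩

/-- A self-similar-type field with profile `U`: `u(s, x) = (−s)^{-1/2} U(x/√(−s))`. -/
def ssField (U : E3 → E3) : ℝ → E3 → E3 := fun s x => (Real.sqrt (-s))⁻¹ • U ((Real.sqrt (-s))⁻¹ • x)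

/-- Calibration: on a self-similar-type field the meter reads the PROFILE NORM `‖U η‖`, independently of
`s` — the reading behind the open residual `Row_A2arP` (a profile loud on `‖η‖ ≤ K` only is invisible to
the decided rows, all of which need a dense quiet set). -/
theorem simAmp_ssField (U : E3 → E3) {s : ℝ} (hs : s < 0) (η : E3) : simAmp (ssField U) s η = ‖U η‖ := by
  have hsr : 0 < Real.sqrt (-s) := Real.sqrt_pos.2 (by linarith)
  simp only [simAmp, ssField, smul_smul, inv_mul_cancel₀ hsr.ne', one_smul, norm_smul, norm_inv,
    Real.norm_eq_abs, abs_of_pos hsr]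
  field_simp

/-- Control: a profile supported in the unit ball gives a field quiet (indeed zero) at every similarity
position with `‖η‖ > 1` — NOT a dense set, so no decided row applies (honesty of `Row_A2arP`). -/
theorem control_ssField_quiet_outside (U : E3 → E3) (hU : ∀ η : E3, 1 < ‖η‖ → U η = 0) {η : E3}
    (hη : 1 < ‖η‖) : EvQuiet 0 (ssField U) η :=
  ⟨-1, by norm_num, fun s hs => by rw [simAmp_ssField U (by linarith) η, hU η hη, norm_zero]⟩

end Summit.NavierStokesRegularity.NavierStokesRegularity.Theorems.ScenarioCensus.LoudnessMeter

namespace Summit.NavierStokesRegularity.NavierStokesRegularity.Theorems.ScenarioCensus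

/-! ## Census KEYS (ns `…Theorems.ScenarioCensus`): instrument LOUDNESS METER (block A2) — TREE-decided cells A2arD / A2arB / A2arS / A2arT / A2arL / A2arF / A2arR / A2arK, OPEN row A2arP -/

/-- **Cell A2arD** (DENSE set of similarity positions, each eventually `ε`-quiet (`ε < 1`) on a far-past end ⇒ `u ≡ 0`; master cell): `:= LoudnessMeter.Row_A2arD`. DECIDED. -/
def Row_A2arD : Prop := LoudnessMeter.Row_A2arD
/-- A2arD is EXCLUDED (decided in the tree): `LoudnessMeter.row_A2arD`. -/
theorem row_A2arD_excluded : Row_A2arD := LoudnessMeter.row_A2arD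

/-- **Cell A2arB** (quiet outside a FIXED BALL (bounded active region)): `:= LoudnessMeter.Row_A2arB`. DECIDED. -/
def Row_A2arB : Prop := LoudnessMeter.Row_A2arB
/-- A2arB is EXCLUDED (decided in the tree): `LoudnessMeter.row_A2arB`. -/
theorem row_A2arB_excluded : Row_A2arB := LoudnessMeter.row_A2arB

/-- **Cell A2arS** (quiet outside SUB-PARABOLIC balls `r(s)/√(−s) → 0`): `:= LoudnessMeter.Row_A2arS`. DECIDED. -/
def Row_A2arS : Prop := LoudnessMeter.Row_A2arS
/-- A2arS is EXCLUDED (decided in the tree): `LoudnessMeter.row_A2arS`. -/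
theorem row_A2arS_excluded : Row_A2arS := LoudnessMeter.row_A2arS

/-- **Cell A2arT** (quiet outside a fixed TUBE): `:= LoudnessMeter.Row_A2arT`. DECIDED. -/
def Row_A2arT : Prop := LoudnessMeter.Row_A2arT
/-- A2arT is EXCLUDED (decided in the tree): `LoudnessMeter.row_A2arT`. -/
theorem row_A2arT_excluded : Row_A2arT := LoudnessMeter.row_A2arT

/-- **Cell A2arL** (quiet outside a fixed SLAB): `:= LoudnessMeter.Row_A2arL`. DECIDED. -/
def Row_A2arL : Prop := LoudnessMeter.Row_A2arL
/-- A2arL is EXCLUDED (decided in the tree): `LoudnessMeter.row_A2arL`. -/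
theorem row_A2arL_excluded : Row_A2arL := LoudnessMeter.row_A2arL

/-- **Cell A2arF** (quiet outside a fixed-radius core with CONVERGENT similarity position): `:= LoudnessMeter.Row_A2arF`. DECIDED. -/
def Row_A2arF : Prop := LoudnessMeter.Row_A2arF
/-- A2arF is EXCLUDED (decided in the tree): `LoudnessMeter.row_A2arF`. -/
theorem row_A2arF_excluded : Row_A2arF := LoudnessMeter.row_A2arF

/-- **Cell A2arR** (quiet outside a fixed-radius RUNAWAY core): `:= LoudnessMeter.Row_A2arR`. DECIDED. -/
def Row_A2arR : Prop := LoudnessMeter.Row_A2arR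
/-- A2arR is EXCLUDED (decided in the tree): `LoudnessMeter.row_A2arR`. -/
theorem row_A2arR_excluded : Row_A2arR := LoudnessMeter.row_A2arR

/-- **Cell A2arK** (quiet parabolic CORES of every aperture): `:= LoudnessMeter.Row_A2arK`. DECIDED. -/
def Row_A2arK : Prop := LoudnessMeter.Row_A2arK
/-- A2arK is EXCLUDED (decided in the tree): `LoudnessMeter.row_A2arK`. -/
theorem row_A2arK_excluded : Row_A2arK := LoudnessMeter.row_A2arK

/-- **Row A2arP** (PARABOLOIDAL active region — the residual) — typed only: `:= LoudnessMeter.Row_A2arP`. OPEN (no witness, no proof). -/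
@[conjecture] def Row_A2arP : Prop := LoudnessMeter.Row_A2arP

end Summit.NavierStokesRegularity.NavierStokesRegularity.Theorems.ScenarioCensus

end
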